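import Summits.QuantumFields.YangMills.Theorems.FreeEnergyWindowChannel.Negative.TorusRemainderRigidity
import Literature.MathematicalPhysics.QuantumFieldTheory.WilsonFinTorusPartitionComplex
import HarnessLib

/-!
# Pointwise torus-remainder rigidity (line `Sketch`, layer 4, registered stub `stub_rigidityAt`)

Crux `FreeEnergyWindowChannel` (stmt-QuantumFields-18842, route `ComplexCouplingChannel` of `QuantumFields/YangMills`).

The landed `torusRemainder_tendsto_zero_of_freeEnergyWindowChannel` (`TorusRemainderRigidity.lean`) derives the vanishing of
the symmetric-torus remainder from the crux's FULL binder prefix (`∀ G, ∀ r, ∃ β₁, ∀ β ≥ β₁`).  Its proof is local in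
`(G, r, β)`; this file records the POINTWISE form, so that any planner repair of the crux's binder prefix (e.g. the
hypothesis `[SimplyConnectedSpace G]` suggested by the `SO(3)` flux obstruction) inherits it verbatim:

* `stub_rigidityAt` — at a fixed admissible `(G, r)` and a fixed real `β`: if for every `ρ > 0` there is a window
  channel at `(β, ρ)` (open connected `D ∋ β` through a real `x`, `|x| < ρ`, one holomorphic `f`, one constant `M`,
  `Z_P z ≠ 0 ∧ |log ‖Z_P z‖ + P⁴ Re f z| ≤ M` for `P ≥ P₀`), then some real `F` has `log Z(β; P⁴) + P⁴ F → 0`.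
  Proof: take the window at `ρ = ρ₀/2` (`ρ₀` the proved anchor's radius), pin `Re f = Re f_A` on the overlap with the
  anchor disc (Archimedean step), and run the landed engine `remainder_tendsto_zero_of_window_of_pinning` at `β`.

References: R. Nevanlinna, *Eindeutige analytische Funktionen* (1936) §III.2; the route file
`Summits/QuantumFields/YangMills/Theses/ComplexCouplingChannel.lean`.
-/

set_option autoImplicit false

noncomputable section

open scoped Topology
open MeasureTheory Filter Set Metric Complex
open Literature.MathematicalPhysics.QuantumFieldTheory

namespace Summit.QuantumFields.YangMills.Theorems.FreeEnergyWindowChannel.Negative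

/-- **Pointwise rigidity from one window reaching the anchor disc.**  At a fixed admissible `(G, r)` and real `β`: a
window channel at `β` through a real point `x` with `|x| < ρ₀/2`, `ρ₀` the radius of the proved strong-coupling anchor,
forces `log Z(β; P⁴) + P⁴ Re f β → 0`.  (The anchor's data are taken as hypotheses `hρA`, so that the statement does not
depend on the choice inside `complexStrongCouplingAnchor_proof`.) [folklore] -/
theorem remainder_tendsto_zero_of_windowAt_of_anchor
    {G : Type} [Group G] [TopologicalSpace G] [IsTopologicalGroup G] [CompactSpace G] [MeasurableSpace G]
    [BorelSpace G] [SecondCountableTopology G] (r : LatticeRep G) {β : ℝ}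
    {ρ₀ c C : ℝ} (hρ₀ : 0 < ρ₀) (hc : 0 < c) {fA : ℂ → ℂ}
    (hA : ∀ P : ℕ, 1 ≤ P → ∀ z : ℂ, ‖z‖ < ρ₀ → wilsonFinTorusPartitionC r.ρ z P P P P ≠ 0 ∧
      |Real.log ‖wilsonFinTorusPartitionC r.ρ z P P P P‖ + (P : ℝ) ^ 4 * (fA z).re| ≤
        C * (P : ℝ) ^ 4 * Real.exp (-(c * P)))
    {D : Set ℂ} (hDo : IsOpen D) (hDc : IsConnected D) (hβD : (β : ℂ) ∈ D)
    {x : ℝ} (hxρ : |x| < ρ₀ / 2) (hxD : (x : ℂ) ∈ D)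
    {f : ℂ → ℂ} (hf : DifferentiableOn ℂ f D) {M : ℝ} {P₀ : ℕ}
    (hwin : ∀ P : ℕ, P₀ ≤ P → ∀ z ∈ D, wilsonFinTorusPartitionC r.ρ z P P P P ≠ 0 ∧
      |Real.log ‖wilsonFinTorusPartitionC r.ρ z P P P P‖ + (P : ℝ) ^ 4 * (f z).re| ≤ M) :
    Tendsto (fun P : ℕ => Real.log (wilsonFinTorusPartition r.ρ β P P P P) + (P : ℝ) ^ 4 * (f β).re)
      atTop (𝓝 0) := by
  set Z : ℕ → ℂ → ℂ := fun P z => wilsonFinTorusPartitionC r.ρ z P P P P with hZ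
  have hZd : ∀ P : ℕ, Differentiable ℂ (Z P) := fun P =>
    differentiable_wilsonFinTorusPartitionC r.ρ r.continuous P P P P
  have hA' : ∀ P : ℕ, 1 ≤ P → ∀ z : ℂ, ‖z‖ < ρ₀ → Z P z ≠ 0 ∧
      |Real.log ‖Z P z‖ + (P : ℝ) ^ 4 * (fA z).re| ≤ C * (P : ℝ) ^ 4 * Real.exp (-(c * P)) :=
    fun P hP z hz => hA P hP z hz
  have hwin' : ∀ P : ℕ, P₀ ≤ P → ∀ z ∈ D, Z P z ≠ 0 ∧
      |Real.log ‖Z P z‖ + (P : ℝ) ^ 4 * (f z).re| ≤ M := fun P hP z hz => hwin P hP z hz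
  set P₁ : ℕ := max P₀ 1 with hP₁
  -- a uniform exponential bound for the anchor's remainder
  set C' : ℝ := max C 0 with hC'
  have hc2 : 0 < c / 2 := half_pos hc
  set A : ℝ := C' * (24 / (c / 2) ^ 4) + 1 with hAdef
  have hA0 : 0 < A := by rw [hAdef]; positivity
  set ε : ℕ → ℝ := fun P => A * Real.exp (-(c / 2 * P)) with hεdef
  have hε0 : ∀ P : ℕ, 0 < ε P := fun P => by rw [hεdef]; positivity
  have hεt : Tendsto ε atTop (𝓝 0) := by
    have h1 : Tendsto (fun P : ℕ => Real.exp (-(c / 2 * P))) atTop (𝓝 0) := by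
      have := Real.tendsto_exp_neg_atTop_nhds_zero.comp
        ((tendsto_natCast_atTop_atTop (R := ℝ)).const_mul_atTop hc2)
      simpa [Function.comp_def] using this
    simpa [hεdef] using h1.const_mul A
  have hanchor_le : ∀ P : ℕ, C * (P : ℝ) ^ 4 * Real.exp (-(c * P)) ≤ ε P := by
    intro P
    have hP0 : (0 : ℝ) ≤ P := Nat.cast_nonneg P
    have h24 := Summit.QuantumFields.YangMills.Theorems.ComplexCouplingChannel.pow_four_mul_exp_neg_le hc2 hP0
    have hsplit : Real.exp (-(c * P)) = Real.exp (-(c / 2 * P)) * Real.exp (-(c / 2 * P)) := by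
      rw [← Real.exp_add]; congr 1; ring
    have hX : 0 ≤ (P : ℝ) ^ 4 * Real.exp (-(c * P)) := by positivity
    calc C * (P : ℝ) ^ 4 * Real.exp (-(c * P)) = C * ((P : ℝ) ^ 4 * Real.exp (-(c * P))) := by ring
      _ ≤ C' * ((P : ℝ) ^ 4 * Real.exp (-(c * P))) := mul_le_mul_of_nonneg_right (le_max_left _ _) hX
      _ = C' * ((P : ℝ) ^ 4 * Real.exp (-(c / 2 * P))) * Real.exp (-(c / 2 * P)) := by rw [hsplit]; ring
      _ ≤ C' * (24 / (c / 2) ^ 4) * Real.exp (-(c / 2 * P)) :=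
          mul_le_mul_of_nonneg_right (mul_le_mul_of_nonneg_left h24 (le_max_right _ _)) (Real.exp_pos _).le
      _ ≤ A * Real.exp (-(c / 2 * P)) := by
          gcongr; rw [hAdef]; linarith
      _ = ε P := by rw [hεdef]
  -- Step 1: on the overlap the two windows pin `Re f = Re f_A`
  have hre : ∀ w ∈ D, ‖w‖ < ρ₀ → (f w).re = (fA w).re := by
    intro w hwD hw
    have key : ∀ s : ℝ, (s = (f w).re - (fA w).re ∨ s = (fA w).re - (f w).re) → s ≤ 0 := by
      intro s hs
      refine nonpos_of_forall_pow_four_mul_le (P₀ := P₁) (K := M + A) fun P hP => ?_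
      have hP₀ : P₀ ≤ P := (le_max_left _ _).trans hP
      have hP1 : 1 ≤ P := (le_max_right _ _).trans hP
      have h1 := (hwin' P hP₀ w hwD).2
      have h2 := ((hA' P hP1 w hw).2).trans (hanchor_le P)
      have hεA : ε P ≤ A := by
        rw [hεdef]
        have : Real.exp (-(c / 2 * P)) ≤ 1 := by
          rw [Real.exp_le_one_iff]; nlinarith [hc2, (Nat.cast_nonneg P : (0 : ℝ) ≤ P)]
        nlinarith [hA0]
      rw [abs_le] at h1 h2
      rcases hs with hs | hs <;> rw [hs] <;> nlinarith [h1.1, h1.2, h2.1, h2.2, hεA]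
    have h1 := key _ (Or.inl rfl)
    have h2 := key _ (Or.inr rfl)
    linarith
  -- Step 2: pinning of the remainder on `D ∩ ball x (ρ₀/2)`
  have hpin : ∀ P : ℕ, P₁ ≤ P → ∀ w ∈ D, dist w (x : ℂ) < ρ₀ / 2 →
      |Real.log ‖Z P w‖ + (P : ℝ) ^ 4 * (f w).re| ≤ ε P := by
    intro P hP w hwD hwx
    have hw : ‖w‖ < ρ₀ := by
      have hxn : ‖(x : ℂ)‖ < ρ₀ / 2 := by rw [norm_real, Real.norm_eq_abs]; exact hxρ
      calc ‖w‖ = ‖(w - x) + x‖ := by ring_nf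
        _ ≤ ‖w - (x : ℂ)‖ + ‖(x : ℂ)‖ := norm_add_le _ _
        _ < ρ₀ / 2 + ρ₀ / 2 := by rw [← dist_eq_norm]; exact add_lt_add hwx hxn
        _ = ρ₀ := by ring
    rw [hre w hwD hw]
    exact ((hA' P ((le_max_right _ _).trans hP) w hw).2).trans (hanchor_le P)
  -- Step 3: the engine at `β`
  have hwin₁ : ∀ P : ℕ, P₁ ≤ P → ∀ z ∈ D, Z P z ≠ 0 ∧
      |Real.log ‖Z P z‖ + (P : ℝ) ^ 4 * (f z).re| ≤ M :=
    fun P hP z hz => hwin' P ((le_max_left _ _).trans hP) z hz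
  have hlim := remainder_tendsto_zero_of_window_of_pinning Z D hDo hDc.isPreconnected hZd (x : ℂ) hxD
    (ρ₀ / 2) (half_pos hρ₀) f hf M P₁ hwin₁ ε hε0 hεt hpin (β : ℂ) hβD
  -- Step 4: at real `β` the complex partition function is the (positive) real one
  have hnorm : ∀ P : ℕ, ‖Z P (β : ℂ)‖ = wilsonFinTorusPartition r.ρ β P P P P := fun P => by
    simp only [hZ, wilsonFinTorusPartitionC_ofReal, Complex.norm_real, Real.norm_eq_abs]
    exact abs_of_pos (wilsonFinTorusPartition_pos r.continuous β P P P P)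
  simpa only [hnorm] using hlim

/-- **Registered stub `stub_rigidityAt` of line `Sketch`** (layer 4, lead c2): POINTWISE torus-remainder rigidity.  At a
fixed admissible `(G, r)` and real `β`, if a window channel at `(β, ρ)` exists for every `ρ > 0`, then some real `F` has
`log Z(β; P⁴) + P⁴ F → 0` as `P → ∞` (take `ρ = ρ₀/2` for the proved anchor's radius `ρ₀` and `F = Re f β`). [folklore] -/
theorem stub_rigidityAt :
    ∀ (G : Type) [Group G] [TopologicalSpace G] [IsTopologicalGroup G] [CompactSpace G] [MeasurableSpace G] [BorelSpace G], Literature.MathematicalPhysics.QuantumFieldTheory.IsCompactSimpleLieGroup G → ∀ r : Literature.MathematicalPhysics.QuantumFieldTheory.LatticeRep G, ∀ β : ℝ,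
      (∀ ρ : ℝ, 0 < ρ →
        ∃ D : Set ℂ, IsOpen D ∧ IsConnected D ∧ (β : ℂ) ∈ D ∧ (∃ x : ℝ, |x| < ρ ∧ (x : ℂ) ∈ D) ∧
          ∃ f : ℂ → ℂ, DifferentiableOn ℂ f D ∧ ∃ M : ℝ, ∃ P₀ : ℕ, ∀ P : ℕ, P₀ ≤ P → ∀ z ∈ D,
            Literature.MathematicalPhysics.QuantumFieldTheory.wilsonFinTorusPartitionC r.ρ z P P P P ≠ 0 ∧
              |Real.log ‖Literature.MathematicalPhysics.QuantumFieldTheory.wilsonFinTorusPartitionC r.ρ z P P P P‖ +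
                (P : ℝ) ^ 4 * (f z).re| ≤ M) →
      ∃ F : ℝ, Filter.Tendsto (fun P : ℕ =>
        Real.log (Literature.MathematicalPhysics.QuantumFieldTheory.wilsonFinTorusPartition r.ρ β P P P P) +
          (P : ℝ) ^ 4 * F) Filter.atTop (nhds 0) := by
  intro G _ _ _ _ _ _ hG r β hβ
  haveI : SecondCountableTopology G :=
    (r.continuous.isClosedEmbedding r.injective).isEmbedding.secondCountableTopology
  obtain ⟨ρ₀, hρ₀, c, hc, -, fA, -, C, hA⟩ :=
    Summit.QuantumFields.YangMills.Theorems.complexStrongCouplingAnchor_proof G hG r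
  obtain ⟨D, hDo, hDc, hβD, ⟨x, hxρ, hxD⟩, f, hf, M, P₀, hwin⟩ := hβ (ρ₀ / 2) (half_pos hρ₀)
  exact ⟨(f β).re, remainder_tendsto_zero_of_windowAt_of_anchor r hρ₀ hc (fun P hP z hz => hA P hP z hz) hDo hDc hβD
    hxρ hxD hf (fun P hP z hz => hwin P hP z hz)⟩

end Summit.QuantumFields.YangMills.Theorems.FreeEnergyWindowChannel.Negative

end
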